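import Mathlib
import HarnessLib
import Summits.HubbardSuperconductivity.HubbardSuperconductivity.Theorems.WeakCouplingBCSKlCertTPrimeAnalyticOps

/-!
# «(KLSCAN)-TPRIME-SOUNDNESS» (2/5): bottom states and the `U`-reductions, generic

Cell `gate-hubbard-kl`, seat p3 (g20); located item «(KLSCAN)-TPRIME-SOUNDNESS» (pen (R269)(D)/(R279); director INBOX l.284 KL-MARGIN-SCAN (α)).
HYPOTHESIS STYLE: the t′ = 0 soundness chain behind `klb1gd_window(_U)` (`…ChannelOps` → `…BottomStates` → `…ChannelBound` → `…ChannelFar` →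
`…BlockBounds` → `…KlCertFormD`) re-keyed VERBATIM at an arbitrary dispersion `ε` / at `squareDispersion 1 tp`, with the five analytic leaves
(finite Fermi-curve measure, `D₄` measure preservation, Hilbert–Schmidt Lindhard kernel, `D₄`-invariance of `χ₀`, channel-state existence) carried
as ONE hypothesis `KLTPAnalytic ε μ` instead of the registered `stub_kl*` leaves (which prove them at `t′ = 0`, `μ ∈ (−4,0)`: `klTPAnalytic_zero`).
Nothing here asserts a certificate at any `t′ ≠ 0`, the margin, the window or superconductivity.  `--supports stmt-HubbardSuperconductivity-0158` (helper).
References: M. Reed, B. Simon, *Methods of Modern Mathematical Physics* I Thm. VI.16/VI.23, IV Thm. XIII.5; S. Raghu, S. A. Kivelson, D. J. Scalapino,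
Phys. Rev. B 81 (2010) 224505, §II–§III.
This file: `kltp_bs_pairingForm_eq/_toLp/_repr/_range_eq`, `kltp_bottomStates` (twins of `…BottomStates`); `kltp_hs_pairingForm_sq`,
`kltp_hs_channelInf_sq`, `kltp_hs_sq_channelInf_one_le` (twins of `…ReductionHS` §Frame).
-/

noncomputable section

set_option linter.dupNamespace false

namespace Summit.HubbardSuperconductivity.HubbardSuperconductivity.Theorems

open MeasureTheory Literature.MathematicalPhysics.QuantumLattice Literature.Analysis.OperatorTheory CwKLChiralWindow
open Summit.HubbardSuperconductivity.HubbardSuperconductivity.Theorems.CwKLChiralWindow.Negative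
open scoped InnerProductSpace Pointwise

/-! ## BottomStates, generic -/

section BottomStatesTP

variable {ε : Momentum → ℝ} {μ : ℝ} {χ : D4Irrep}
  {A P : Lp ℝ 2 (fermiCurveMeasure ε μ) →L[ℝ] Lp ℝ 2 (fermiCurveMeasure ε μ)}

/-- **The pairing form of a non-`A1g` channel state at `U = 1` is the Lindhard form**:
`pairingForm ε₀ μ 1 ψ = ∫ ψ(k) (∫ χ₀(k + k') ψ(k') dσ_μ) dσ_μ` for `μ ∈ (-4, 0)`, `χ ≠ A1g` and every
channel-`χ` state `ψ` (splitting of the form and vanishing mean). [folklore] -/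
theorem kltp_bs_pairingForm_eq (hμ : KLTPAnalytic ε μ) (hχ : χ ≠ D4Irrep.A1g)
    {ψ : Momentum → ℝ} (hψ : IsChannelState ε μ χ ψ) :
    pairingForm ε μ 1 ψ =
      ∫ k, ψ k * ∫ k', lindhardFunction ε μ (k + k') * ψ k'
        ∂fermiCurveMeasure ε μ ∂fermiCurveMeasure ε μ := by
  haveI : IsFiniteMeasure (fermiCurveMeasure ε μ) := hμ.1
  have hmean := (stub_klMeanZero ε μ ‹_› hμ.2.1 χ ψ hχ hψ).2
  rw [klhs_frame_pairingForm_split 1 hμ.2.2.1 hψ.1, hmean]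
  ring

/-- **Dictionary, channel state ↦ fixed unit vector.** For a channel-`χ` state `ψ` the class `[ψ] ∈ L²(σ_μ)`
is fixed by `P`, has norm `1`, and `⟪[ψ], A [ψ]⟫ = pairingForm ε₀ μ 1 ψ`. [folklore] -/
theorem kltp_bs_toLp (hμ : KLTPAnalytic ε μ) (hχ : χ ≠ D4Irrep.A1g)
    (hAinner : ∀ φ ψ : Lp ℝ 2 (fermiCurveMeasure ε μ),
      inner ℝ ψ (A φ) = ∫ k, ψ k * ∫ k', lindhardFunction ε μ (k + k') * φ k'
        ∂fermiCurveMeasure ε μ ∂fermiCurveMeasure ε μ)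
    (hPfix : ∀ (ψ : Momentum → ℝ) (hψ : MemLp ψ 2 (fermiCurveMeasure ε μ)),
      InChannel χ ψ → P (hψ.toLp ψ) = hψ.toLp ψ)
    {ψ : Momentum → ℝ} (hψ : IsChannelState ε μ χ ψ) :
    P (hψ.1.toLp ψ) = hψ.1.toLp ψ ∧ ‖hψ.1.toLp ψ‖ = 1 ∧
      ⟪hψ.1.toLp ψ, A (hψ.1.toLp ψ)⟫_ℝ = pairingForm ε μ 1 ψ := by
  have hae : (hψ.1.toLp ψ : Momentum → ℝ) =ᵐ[fermiCurveMeasure ε μ] ψ := hψ.1.coeFn_toLp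
  refine ⟨hPfix ψ hψ.1 hψ.2.2, ?_, ?_⟩
  · have h2 : ‖hψ.1.toLp ψ‖ ^ 2 = 1 := by rw [kl_bs_norm_sq_eq_integral_of_ae_eq hae, hψ.2.1]
    exact (pow_eq_one_iff_of_nonneg (norm_nonneg _) two_ne_zero).1 h2
  · rw [kl_bs_inner_eq_of_ae_eq _ A hAinner hae, kltp_bs_pairingForm_eq hμ hχ hψ]

/-- **Dictionary, fixed unit vector ↦ channel state.** A unit vector `φ ∈ L²(σ_μ)` fixed by `P` is the
class of a channel-`χ` state `ψ` with `pairingForm ε₀ μ 1 ψ = ⟪φ, A φ⟫`. [folklore] -/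
theorem kltp_bs_repr (hμ : KLTPAnalytic ε μ) (hχ : χ ≠ D4Irrep.A1g)
    (hAinner : ∀ φ ψ : Lp ℝ 2 (fermiCurveMeasure ε μ),
      inner ℝ ψ (A φ) = ∫ k, ψ k * ∫ k', lindhardFunction ε μ (k + k') * φ k'
        ∂fermiCurveMeasure ε μ ∂fermiCurveMeasure ε μ)
    (hPrepr : ∀ φ : Lp ℝ 2 (fermiCurveMeasure ε μ), P φ = φ →
      ∃ ψ : Momentum → ℝ, InChannel χ ψ ∧ MemLp ψ 2 (fermiCurveMeasure ε μ) ∧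
        (φ : Momentum → ℝ) =ᵐ[fermiCurveMeasure ε μ] ψ)
    {φ : Lp ℝ 2 (fermiCurveMeasure ε μ)} (hPφ : P φ = φ) (hφ : ‖φ‖ = 1) :
    ∃ ψ : Momentum → ℝ, IsChannelState ε μ χ ψ ∧
      (φ : Momentum → ℝ) =ᵐ[fermiCurveMeasure ε μ] ψ ∧
      pairingForm ε μ 1 ψ = ⟪φ, A φ⟫_ℝ := by
  obtain ⟨ψ, hch, hmem, hae⟩ := hPrepr φ hPφ
  have hstate : IsChannelState ε μ χ ψ :=
    ⟨hmem, by rw [← kl_bs_norm_sq_eq_integral_of_ae_eq hae, hφ, one_pow], hch⟩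
  exact ⟨ψ, hstate, hae, by rw [kltp_bs_pairingForm_eq hμ hχ hstate, kl_bs_inner_eq_of_ae_eq _ A hAinner hae]⟩

/-- **The values of the pairing form on channel states are the Rayleigh quotients of `A` on the fixed
space of `P`.** [folklore] -/
theorem kltp_bs_range_eq (hμ : KLTPAnalytic ε μ) (hχ : χ ≠ D4Irrep.A1g)
    (hAinner : ∀ φ ψ : Lp ℝ 2 (fermiCurveMeasure ε μ),
      inner ℝ ψ (A φ) = ∫ k, ψ k * ∫ k', lindhardFunction ε μ (k + k') * φ k'
        ∂fermiCurveMeasure ε μ ∂fermiCurveMeasure ε μ)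
    (hPfix : ∀ (ψ : Momentum → ℝ) (hψ : MemLp ψ 2 (fermiCurveMeasure ε μ)),
      InChannel χ ψ → P (hψ.toLp ψ) = hψ.toLp ψ)
    (hPrepr : ∀ φ : Lp ℝ 2 (fermiCurveMeasure ε μ), P φ = φ →
      ∃ ψ : Momentum → ℝ, InChannel χ ψ ∧ MemLp ψ 2 (fermiCurveMeasure ε μ) ∧
        (φ : Momentum → ℝ) =ᵐ[fermiCurveMeasure ε μ] ψ) :
    pairingForm ε μ 1 '' {ψ | IsChannelState ε μ χ ψ} =
      {r : ℝ | ∃ φ : Lp ℝ 2 (fermiCurveMeasure ε μ), P φ = φ ∧ ‖φ‖ = 1 ∧ ⟪φ, A φ⟫_ℝ = r} := by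
  ext r
  simp only [Set.mem_image, Set.mem_setOf_eq]
  constructor
  · rintro ⟨ψ, hψ, rfl⟩
    obtain ⟨h1, h2, h3⟩ := kltp_bs_toLp hμ hχ hAinner hPfix hψ
    exact ⟨_, h1, h2, h3⟩
  · rintro ⟨φ, hPφ, hφ, rfl⟩
    obtain ⟨ψ, hψ, -, hval⟩ := kltp_bs_repr hμ hχ hAinner hPrepr hPφ hφ
    exact ⟨ψ, hψ, hval⟩

/-- **Bottom states of a channel (existence and eigen-equation), abstract form.** Let `μ ∈ (-4,0)`, `χ ≠ A1g`,
`A` the (compact, self-adjoint) integral operator of `χ₀(k+k')` on `L²(σ_μ)` and `P` an orthogonal projection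
commuting with `A` whose range is the classes of channel-`χ` functions.  If the channel bottom
`channelInf ε₀ μ 1 χ` is negative, it is attained by a channel state, and every channel state attaining it solves
`∫ χ₀(k+k') ψ(k') dσ(k') = channelInf · ψ(k)` a.e. (for `χ ≠ A1g` channel states are mean-zero, so the pairing
form at `U = 1` is `⟨ψ, Aψ⟩`; spectral theorem for the compact self-adjoint compression of `A` to `ran P`,
Reed–Simon I, Thm. VI.16). [folklore] -/
theorem kltp_bottomStates (ε : Momentum → ℝ) : ∀ μ : ℝ, KLTPAnalytic ε μ → ∀ (χ : D4Irrep)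
    (A P : Lp ℝ 2 (fermiCurveMeasure ε μ) →L[ℝ] Lp ℝ 2 (fermiCurveMeasure ε μ)),
    χ ≠ D4Irrep.A1g →
    (∀ φ : Lp ℝ 2 (fermiCurveMeasure ε μ),
      (A φ : Momentum → ℝ) =ᵐ[fermiCurveMeasure ε μ]
        fun k => ∫ k', lindhardFunction ε μ (k + k') * φ k'
          ∂fermiCurveMeasure ε μ) →
    (∀ φ ψ : Lp ℝ 2 (fermiCurveMeasure ε μ),
      inner ℝ ψ (A φ) =
        ∫ k, ψ k * ∫ k', lindhardFunction ε μ (k + k') * φ k'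
          ∂fermiCurveMeasure ε μ ∂fermiCurveMeasure ε μ) →
    IsSelfAdjoint A → IsCompactOperator A →
    P * P = P → IsSelfAdjoint P → A * P = P * A →
    (∀ (ψ : Momentum → ℝ) (hψ : MemLp ψ 2 (fermiCurveMeasure ε μ)),
      InChannel χ ψ → P (hψ.toLp ψ) = hψ.toLp ψ) →
    (∀ φ : Lp ℝ 2 (fermiCurveMeasure ε μ), P φ = φ →
      ∃ ψ : Momentum → ℝ, InChannel χ ψ ∧ MemLp ψ 2 (fermiCurveMeasure ε μ) ∧
        (φ : Momentum → ℝ) =ᵐ[fermiCurveMeasure ε μ] ψ) →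
    channelInf ε μ 1 χ < 0 →
    (∃ ψ : Momentum → ℝ, IsChannelState ε μ χ ψ ∧
      pairingForm ε μ 1 ψ = channelInf ε μ 1 χ) ∧
    (∀ ψ : Momentum → ℝ, IsChannelState ε μ χ ψ →
      pairingForm ε μ 1 ψ = channelInf ε μ 1 χ →
      ∀ᵐ k ∂fermiCurveMeasure ε μ,
        ∫ k', lindhardFunction ε μ (k + k') * ψ k' ∂fermiCurveMeasure ε μ =
          channelInf ε μ 1 χ * ψ k) := by
  intro μ hμ χ A P hχ hA hAinner hAsa hAc _hPP _hPsa hAP hPfix hPrepr hneg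
  -- the channel bottom is the greatest lower bound of the Rayleigh quotient of `A` on the fixed space of `P`
  set R := pairingForm ε μ 1 '' {ψ | IsChannelState ε μ χ ψ} with hR
  have hinf : channelInf ε μ 1 χ = sInf R := rfl
  have hne : R.Nonempty := by
    by_contra h
    rw [Set.not_nonempty_iff_eq_empty] at h
    rw [hinf, h, Real.sInf_empty] at hneg
    exact lt_irrefl _ hneg
  have hbdd : BddBelow R := by
    by_contra h
    rw [hinf, Real.sInf_of_not_bddBelow h] at hneg
    exact lt_irrefl _ hneg
  have hglb : IsGLB R (channelInf ε μ 1 χ) := Real.isGLB_sInf hne hbdd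
  rw [hR, kltp_bs_range_eq hμ hχ hAinner hPfix hPrepr] at hglb
  -- the abstract bottom of a compact self-adjoint operator in a symmetry sector
  obtain ⟨⟨φ, hPφ, hφ, hval⟩, heig⟩ :=
    Literature.Analysis.OperatorTheory.exists_rayleigh_eq_of_isGLB_of_neg_of_commute_real hAsa hAc hAP hglb hneg
  refine ⟨?_, fun ψ hψ hmin => ?_⟩
  · obtain ⟨ψ, hψ, -, hval'⟩ := kltp_bs_repr hμ hχ hAinner hPrepr hPφ hφ
    exact ⟨ψ, hψ, hval'.trans hval⟩
  · obtain ⟨h1, h2, h3⟩ := kltp_bs_toLp hμ hχ hAinner hPfix hψ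
    have hAφ := heig _ h1 h2 (h3.trans hmin)
    have hae := hA (hψ.1.toLp ψ)
    rw [hAφ] at hae
    filter_upwards [hae, Lp.coeFn_smul (channelInf ε μ 1 χ) (hψ.1.toLp ψ),
      hψ.1.coeFn_toLp] with k hk hsmul hrep
    rw [← kl_bs_kernelIntegral_congr _ hψ.1.coeFn_toLp k, ← hk, hsmul, Pi.smul_apply, smul_eq_mul, hrep]

end BottomStatesTP

/-! ## ReductionHS twins (U²-homogeneity, bare-U penalty), generic -/

section FrameTP

variable {ε : Momentum → ℝ} {μ : ℝ}

/-- **`U²`-homogeneity of the pairing form on mean-zero `L²` gap functions** (from (K), (F)). [folklore] -/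
theorem kltp_hs_pairingForm_sq (hμ : KLTPAnalytic ε μ) (U : ℝ) {ψ : Momentum → ℝ}
    (hψ : MemLp ψ 2 (fermiCurveMeasure ε μ))
    (h0 : ∫ k, ψ k ∂fermiCurveMeasure ε μ = 0) :
    pairingForm ε μ U ψ = U ^ 2 * pairingForm ε μ 1 ψ := by
  rw [(kltp_frameHS ε μ hμ U ψ hψ).1, (kltp_frameHS ε μ hμ 1 ψ hψ).1, h0]
  ring

/-- **`U²`-homogeneity of the channel bottom off `A1g`** (from (K), (F) and mean zero). [folklore] -/
theorem kltp_hs_channelInf_sq (hμ : KLTPAnalytic ε μ) (U : ℝ) (χ : D4Irrep)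
    (hmean : ∀ ψ, IsChannelState ε μ χ ψ →
      ∫ k, ψ k ∂fermiCurveMeasure ε μ = 0) :
    channelInf ε μ U χ = U ^ 2 * channelInf ε μ 1 χ := by
  unfold channelInf
  have himg : (pairingForm ε μ U) '' {ψ | IsChannelState ε μ χ ψ}
      = (U ^ 2) • ((pairingForm ε μ 1) ''
          {ψ | IsChannelState ε μ χ ψ}) := by
    rw [← Set.image_smul, Set.image_image]
    apply Set.image_congr
    intro ψ hψ
    show pairingForm ε μ U ψ = U ^ 2 • pairingForm ε μ 1 ψ
    rw [kltp_hs_pairingForm_sq hμ U hψ.1 (hmean ψ hψ), smul_eq_mul]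
  rw [himg, Real.sInf_smul_of_nonneg (sq_nonneg U), smul_eq_mul]

/-- **The bare-`U` penalty** for `0 < U ≤ 1` and any channel (from (K), (F)): `U² Λ₁(χ) ≤ Λ_U(χ)`. [folklore] -/
theorem kltp_hs_sq_channelInf_one_le (hμ : KLTPAnalytic ε μ) {U : ℝ} (hU0 : 0 < U) (hU1 : U ≤ 1) (χ : D4Irrep) :
    U ^ 2 * channelInf ε μ 1 χ ≤ channelInf ε μ U χ := by
  unfold channelInf
  set S := {ψ | IsChannelState ε μ χ ψ} with hS
  set H : ℝ := Real.sqrt (∫ z, (lindhardFunction ε μ (z.1 + z.2)) ^ 2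
      ∂(fermiCurveMeasure ε μ).prod (fermiCurveMeasure ε μ)) with hH
  rcases (pairingForm ε μ U '' S).eq_empty_or_nonempty with hSe | hSne
  · have hSe' : pairingForm ε μ 1 '' S = ∅ := by
      rw [Set.image_eq_empty] at hSe ⊢; exact hSe
    rw [hSe, hSe', Real.sInf_empty, mul_zero]
  · have hbb : BddBelow (pairingForm ε μ 1 '' S) := by
      refine ⟨-H, ?_⟩
      rintro x ⟨ψ, hψ, rfl⟩
      obtain ⟨hsplit, hbd⟩ := kltp_frameHS ε μ hμ 1 ψ hψ.1
      rw [hsplit, hψ.2.1, one_mul] at *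
      have := neg_abs_le (∫ k, ψ k * ∫ k', lindhardFunction ε μ (k + k') * ψ k'
            ∂fermiCurveMeasure ε μ ∂fermiCurveMeasure ε μ)
      nlinarith [sq_nonneg (∫ k, ψ k ∂fermiCurveMeasure ε μ)]
    refine le_csInf hSne ?_
    rintro x ⟨ψ, hψ, rfl⟩
    have hle : sInf (pairingForm ε μ 1 '' S) ≤ pairingForm ε μ 1 ψ :=
      csInf_le hbb ⟨ψ, hψ, rfl⟩
    have hUU : U ^ 2 ≤ U := by nlinarith
    obtain ⟨hU', _⟩ := kltp_frameHS ε μ hμ U ψ hψ.1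
    obtain ⟨h1', _⟩ := kltp_frameHS ε μ hμ 1 ψ hψ.1
    rw [hU']
    rw [h1'] at hle
    have hI := sq_nonneg (∫ k, ψ k ∂fermiCurveMeasure ε μ)
    have h1 := mul_le_mul_of_nonneg_left hle (sq_nonneg U)
    nlinarith [mul_le_mul_of_nonneg_right hUU hI]

end FrameTP

end Summit.HubbardSuperconductivity.HubbardSuperconductivity.Theorems

end
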